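import Mathlib
import HarnessLib
import HarnessLib.Audit
import Summits.Ventures.QEDPrecision.ThreeLoop.RederivationTargets

/-!
Route: LR1996ThreeLoopRederivation

# Route LR1996ThreeLoopRederivation — Re-derive A1(6) by the cell's exact IBP reduction plus
enclosed master coefficients

It suffices to show X = X1 ∧ X2 ∧ X3 where X1 = the qed-ibp cell's EXACT three-loop reduction
identity (with the published analytic
master coefficients substituted, the cell's reduction rationals reproduce Laporta–Remiddi's closed
form of A₁⁽⁶⁾ and all poles cancel),
X2 = the 67 coefficients of the ten masters the cell has computed numerically lie within 10⁻³⁰ of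
the cell's decimals, X3 = the 28
coefficients of the seven λ-route masters lie within 10⁻³⁰ of their centres. X is, verbatim, the
registered rung leaf
`ThreeLoop.A1SixRederived := ReductionIdentity ∧ (MastersEnclosedCell ∧ MastersEnclosedLambda)`
(venture rulings D-0059/D-0061): an
INDEPENDENT derivation of an already-closed conjunct — `Summit.Ventures.QEDPrecision.Statement` is
proved in the tree by
`Certificates/A1SixEnclosure.statement_holds`; this route never bears on the summit and says so.
Discharge of the two enclosure cruxes is OUT OF SCOPE under venture ruling D-0053 (3):
evidence of record = the cell referee's gate (iii)/(iv) logs; cheapest upgrade = six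
Literature/Analysis constant facts to 35 digits (≈ one
prover-week), not requested. The identity (support item) is proved inside `closes` by `ring`.
Lean: `Summit.Ventures.QEDPrecision.ThreeLoop.A1SixRederived`

## Assembly
Pure logic plus one `ring` call: `A1SixRederived` unfolds to `ReductionIdentity ∧
(MastersEnclosedCell ∧ MastersEnclosedLambda)`; `closes h₂ h₃ := And.intro (identity by simp only +
ring) (And.intro h₂ h₃)` — the two enclosure cruxes are the load-bearing binders.

CLOSES_TARGET: closes rung Q6 of Ventures/QEDPrecision: Summit.Ventures.QEDPrecision.ThreeLoop.A1SixRederived (D-0061; not the summit Statement) — the deciding theorem of this route concludes that registered leaf (Ventures/QEDPrecision: no summit Statement) (class rung: servable and labelled, never counted as concluding the summit Statement).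

Rationale: WHY THIS LINE. The mechanism is Laporta–Remiddi's own: integration-by-parts reduction of the 72
three-loop g−2 diagrams to seventeen master integrals
[LaportaRemiddi1996], whose ε-expansions are known analytically [Laporta2001, LeeSmirnov2011]; the
cell re-ran the reduction with its own
code and re-computed the masters by dimensional recurrence and difference equations (two-run
agreement, 56 to > 200 digits). Typing the
result as `ReductionIdentity ∧ MastersEnclosed` banks the artefact in the tree: the identity is
decidable by `ring` over the opaque
constants (planner check, rc 0), the enclosures are Certificates/ -pattern targets. Nothing is
imported from another area; the line differs
from the closed route (enclosing the published closed form) in that the number is DERIVED, not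
quoted. Negatives index: empty for Ventures.

RANKED CRUXES. #2 CellMastersEnclosed (crux) — the 67 coefficients of G1…G10 (= I18, I15, I13, I12,
I16, I14, I17, I8, I9, I10) lie within 10⁻³⁰ of the cell's 40-digit centres (typed target
`ThreeLoop.MastersEnclosedCell`). [difficulty: L] (why it might fail: discharge needs enclosures of
π, ln 2, ζ(3), ζ(5), Li₄(½), Li₅(½) to ≈35 digits; the tree has 20 — without six new constant facts
the conjuncts with transcendental content cannot be closed in Lean.) [LeeSmirnov2011, Laporta2001]
#3 LambdaMastersEnclosed (crux) — the 28 coefficients of G11…G17 (= I5, I2, I3, I7, I4, I6, J0) lie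
within 10⁻³⁰ of their 40-digit centres (typed target `ThreeLoop.MastersEnclosedLambda`; centres are
analytic-value placeholders until the cell's λ-route decimals land). [difficulty: L] (why it might
fail: same constant-enclosure prerequisite as rank 2; in addition the cell's own decimals for these
seven masters are still owed (gate (iii), due 2026-08-26) and could disagree with the placeholders.)
[LeeSmirnov2011, Laporta2001]
#9 CellReductionIdentity (support) — the cell's exact reduction identity — row ε⁰: a1Six = CT₀ + Σ
c·M over the 95 consumed (master, order) pairs; rows ε⁻¹…ε⁻³: pole cancellation (typed target
`ThreeLoop.ReductionIdentity`, p404584); provable now by `simp only [ReductionIdentity, a1Six];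
refine ⟨?_, ?_, ?_, ?_⟩ <;> ring` (planner check rc 0, 38 s) and proved INSIDE `closes`; any seat
may also land it as a named theorem (= the cell's 0c CLOSED-EXACT in the kernel). [difficulty:
provable-now] [LaportaRemiddi1996, Laporta2001, LeeSmirnov2011]

TWO-LAYER PLAN. If constant facts to 35 digits land, CellMastersEnclosed splits per master (G2…G10;
G1 is rational) with glue = conjunction; nothing filed now.

KILL CRITERIA. A `ring` failure inside `closes` after p404584 applies unchanged kills the route at
birth (the cell's 0c result would be wrong) — already excluded by the planner check. A cell decimal
for G11…G17 disagreeing with its placeholder centre beyond 10⁻³⁰ forces a restatement of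
LambdaMastersEnclosed with the cell's centre and is reported as a gate-(iii) failure of the cell,
not hidden.

NOT DECOMPOSED YET. Per-master enclosure items and the six constant-enclosure facts (π, ln 2, ζ(3),
ζ(5), Li₄(½), Li₅(½) to 35 digits) — layer 2, only if a Lean-prover seat is ever granted (venture
ruling D-0053 (3) forbids growing the programme).

CHEAPEST FALSIFIER. `example : ReductionIdentity := by simp only [ReductionIdentity, a1Six]; refine
⟨?_, ?_, ?_, ?_⟩ <;> ring` — RUN by the planner on 2026-08-25 (lean check rc 0, 38 s): it holds.

NUMBERS. Half-width 10⁻³⁰ per coefficient; Σ|c| over the 95 pairs = 7.474·10³, so the identity plus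
all enclosures bound a1Six to 7.5·10⁻²⁷ around Σ c·q + CT₀ (R1 asks 10⁻¹⁵). Cell certified digits:
I13–I18 ≥ 150, I8 ≥ 200, I9/I10 ≥ 106, I12 ≥ 56; owed I2…I7, J0 targets 75–110 (gate (iv) §B14).

DEFINITION REQUESTS. Constant enclosures to 35 digits as Literature facts (π, ln 2, ζ(3), ζ(5),
Li₄(½), Li₅(½)) — NOT requested now (out of wind-down scope); recorded so a later seat knows the
exact prerequisite.

Novelty: Searches (2026-08-25): lean search 'a1Six|li4Half|lsBracket' (tree: LR1996 AnalyticCoefficients,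
LeeSmirnov2011 ThreeLoopMastersAnalytic, Certificates/A1SixEnclosure); lit keys
paper:arxiv-1010.1334 (LeeSmirnov2011), hep-ph/9602417 (LaportaRemiddi1996), hep-ph/0111123
(Laporta2001) held and read by the cell's lit seat.
Nearest prior art found: LaportaRemiddi1996 (the original derivation) and LeeSmirnov2011 (analytic
masters); in-tree Certificates/A1SixEnclosure (encloses the quoted closed form).
Delta: the same derivation re-executed by independent code and typed so that the reduction step is
kernel-decidable — verification value, no new mathematics.
Claimed grade: known  [refs: paper:arxiv-1010.1334, LeeSmirnov2011, LaportaRemiddi1996, Laporta2001]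

Barriers (technique_class: certified-computation, integration-by-parts): - technique_class: certified-computation, integration-by-parts
- Negatives index: empty at filing (no refuted statements under Ventures)

History (route lifecycle, newest last):
- 2026-08-26T01:16:00Z · AUTO-CRUX (edit): CellReductionIdentity — hypotheses of the deciding theorem that nothing in the route derives are cruxes (planner-qed-ibp-lead-g6-0)

sub-problem: QEDPrecision · status: draft · opened planner-qed-ibp-lead-g6-0 2026-08-26T01:07:09Z · rev 2 · ledger route-Ventures-LR1996ThreeLoopRederivation
GENERATED by the gate from the ledger (D-0016/17). Provers cite these decls: `theorem foo : Summit.Ventures.QEDPrecision.Theses.LR1996ThreeLoopRederivation.<Decl> := …` in Summits/Ventures/QEDPrecision/Theorems/<Name>.lean.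
-/

namespace Summit.Ventures.QEDPrecision.Theses.LR1996ThreeLoopRederivation

open scoped BigOperators Topology Manifold Classical MeasureTheory ProbabilityTheory Matrix InnerProductSpace ComplexConjugate ContinuousMap
open Filter Set Function TopologicalSpace MeasureTheory

-- H21.Audit: Ventures rung route — no summit Statement decl; the expected conclusion is the closer leaf tagged below
attribute [summit_statement] _root_.Summit.Ventures.QEDPrecision.ThreeLoop.A1SixRederived

/-- item stmt-Ventures-19140 · crux · rank 2 · open · by planner
why it might fail: discharge needs enclosures of π, ln 2, ζ(3), ζ(5), Li₄(½), Li₅(½) to ≈35 digits; the tree has 20 — without six new constant facts the conjuncts with transcendental content cannot be closed in Lean.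
sources: LeeSmirnov2011, Laporta2001
[crux] the 67 coefficients of G1…G10 (= I18, I15, I13, I12, I16, I14, I17, I8, I9, I10) lie within
10⁻³⁰ of the cell's 40-digit centres (typed target `ThreeLoop.MastersEnclosedCell`). [difficulty: L] -/
@[route_item "route-Ventures-LR1996ThreeLoopRederivation"]
def CellMastersEnclosed : Prop :=
  Summit.Ventures.QEDPrecision.ThreeLoop.MastersEnclosedCell

/-- item stmt-Ventures-19141 · crux · rank 3 · open · by planner
why it might fail: same constant-enclosure prerequisite as rank 2; in addition the cell's own decimals for these seven masters are still owed (gate (iii), due 2026-08-26) and could disagree with the placeholders.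
sources: LeeSmirnov2011, Laporta2001
[crux] the 28 coefficients of G11…G17 (= I5, I2, I3, I7, I4, I6, J0) lie within 10⁻³⁰ of their
40-digit centres (typed target `ThreeLoop.MastersEnclosedLambda`; centres are analytic-value
placeholders until the cell's λ-route decimals land). [difficulty: L] -/
@[route_item "route-Ventures-LR1996ThreeLoopRederivation"]
def LambdaMastersEnclosed : Prop :=
  Summit.Ventures.QEDPrecision.ThreeLoop.MastersEnclosedLambda

/-- item stmt-Ventures-19142 · crux (kind.auto-crux: conjecture-grade) · rank 9 · closed · proved by Summit.Ventures.QEDPrecision.ThreeLoop.reductionIdentity_holds (planner) · by planner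
why it might fail: auto-crux — conjecture-grade statement (statement references the registered conjecture Summit.Ventures.QEDPrecision.ThreeLoop.ReductionIdentity); it is open, so it may simply be false
sources: LaportaRemiddi1996, Laporta2001, LeeSmirnov2011
[support] the cell's exact reduction identity — row ε⁰: a1Six = CT₀ + Σ c·M over the 95 consumed
(master, order) pairs; rows ε⁻¹…ε⁻³: pole cancellation (typed target `ThreeLoop.ReductionIdentity`,
p404584); provable now by `simp only [ReductionIdentity, a1Six]; refine ⟨?_, ?_, ?_, ?_⟩ <;> ring`
(planner check rc 0, 38 s) and proved INSIDE `closes`; any seat may also land it as a named theorem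
(= the cell's 0c CLOSED-EXACT in the kernel). [difficulty: provable-now] -/
@[route_item "route-Ventures-LR1996ThreeLoopRederivation"]
def CellReductionIdentity : Prop :=
  Summit.Ventures.QEDPrecision.ThreeLoop.ReductionIdentity

/-- item stmt-Ventures-19149 · aside (kind.auto-crux: conjecture-grade) · rank 1 · open · by planner
why it might fail: auto-crux — conjecture-grade statement (statement references the registered conjecture Summit.Ventures.QEDPrecision.ThreeLoop.MastersEnclosedLambda); it is open, so it may simply be false
sources: LaportaRemiddi1996
[assembly] CellMastersEnclosed → LambdaMastersEnclosed → A1SixRederived (the identity is proved, not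
assumed) -/
@[route_item "route-Ventures-LR1996ThreeLoopRederivation"]
def Assembly : Prop :=
  Summit.Ventures.QEDPrecision.ThreeLoop.MastersEnclosedCell → Summit.Ventures.QEDPrecision.ThreeLoop.MastersEnclosedLambda → Summit.Ventures.QEDPrecision.ThreeLoop.A1SixRederived

/-! D-0027 §2.1 — DECIDING THEOREM (planner-authored via `route open/edit --closes-file`; by planner-qed-ibp-lead-g6-0 2026-08-26T01:13:04Z):
its hypotheses are this route's items and its conclusion the registered leaf `Summit.Ventures.QEDPrecision.ThreeLoop.A1SixRederived` (rung Q6, D-0061) (glue_lint), and it elaborates with this file. -/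

@[closes "route-Ventures-LR1996ThreeLoopRederivation"] theorem closes (h₁ : CellReductionIdentity) (h₂ : CellMastersEnclosed) (h₃ : LambdaMastersEnclosed) :
    Summit.Ventures.QEDPrecision.ThreeLoop.A1SixRederived :=
  And.intro h₁ (And.intro h₂ h₃)

end Summit.Ventures.QEDPrecision.Theses.LR1996ThreeLoopRederivation
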